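import Literature.Barriers.CriticalPhenomena.RigorousRGSmallParameterLocalPolynomial
import HarnessLib

/-!
# `RigorousRGSmallParameter` (Slade, Theorem 1.4.1): scale monotonicity of the `T_φ` seminorm
# ([BS-rg-IE] Lemma 3.1.2) — `‖F‖_{T_φ(𝔥',L^j)} ≤ ‖F‖_{T_φ(𝔥,L^{j-1})}` for `𝔥' ≤ 𝔥`

Companion ("proof architecture") file of
`Literature/Barriers/CriticalPhenomena/RigorousRGSmallParameter.lean` (estimates layer behind
Theorem 6.3.1 / `Slade2017_prop822`). [BS-rg-IE] Lemma 3.1.2 ("a monotonicity property of the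
`T_φ` semi-norm under change of scale, which is used repeatedly throughout the paper"), bulk case
`α = ∅` (the only one without observables): "By definition of the norm on test functions …
`‖g‖_{Φ_{j-1}(𝔥_{j-1})} ≤ ‖g‖_{Φ_j(𝔥_j')} ≤ ‖g‖_{Φ_j(𝔥_j'')}` provided … `𝔥_j' ≤ 𝔥_{j-1}`. As a direct
consequence of the definition `‖F‖_{T_φ} = sup_{‖g‖_Φ ≤ 1}|⟨F,g⟩_φ|` … we obtain (scale-change) …
In fact for this case we obtain the stronger inequality with `≺` replaced by `≤`." With the
lattice norms `Φ(𝔥, R)` of `…TestFunctionNorm` (weights `𝔥^{-|z|}R^{|α|}`, `R = L^j`), all proved: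

* `Tphi.Tnorm_mono_of_ball_subset` (`B(Φ') ⊆ B(Φ) ⇒ ‖·‖_{T(Φ')} ≤ ‖·‖_{T(Φ)}`);
* **`RGNorm.ball_latticeFamily_subset`** (`B(Φ(𝔥',R')) ⊆ B(Φ(𝔥,R))` for `0 < 𝔥' ≤ 𝔥`, `0 < R ≤ R'`);
* **`RGNorm.TphiNorm_mono`** (`‖F‖_{T_φ(Φ(𝔥',R'))} ≤ ‖F‖_{T_φ(Φ(𝔥,R))}`).

Sources: D. C. Brydges, G. Slade, *A renormalisation group method. IV. Stability analysis*, J.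
Stat. Phys. 159 (2015) 530–588, arXiv:1403.7255, §3.1.2, Lemma 3.1.2 (TeX-source numbering).

## References

* [BrydgesSlade2015] D. C. Brydges, G. Slade, *A renormalisation group method. IV. Stability
  analysis*, J. Stat. Phys. **159** (2015) 530–588, arXiv:1403.7255.
-/

noncomputable section

namespace Literature.Barriers.CriticalPhenomena

namespace LongRangePhi4

namespace Tphi

open Finset

variable {Ξ : Type*} [Fintype Ξ]

/-- **The `T`-seminorm is monotone in the unit ball**: if `B(Φ') ⊆ B(Φ)` (and `B(Φ)` is bounded
on short sequences) then `‖F‖_{T(Φ')} ≤ ‖F‖_{T(Φ)}` ("As a direct consequence of the definition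
`‖F‖_{T_φ} = sup_{‖g‖_Φ ≤ 1}|⟨F,g⟩_φ|`"). [cite: BrydgesSlade2015, §3.1.2 (proof of Lemma 3.1.2, case α = ∅)] -/
theorem Tnorm_mono_of_ball_subset {pN : ℕ} {𝓛 𝓛' : Set (TestFunctional Ξ)} {C : ℕ → ℝ} (hC : EvalBound pN 𝓛 C)
    (h : ball pN 𝓛' ⊆ ball pN 𝓛) (F : List Ξ → ℝ) : Tnorm pN 𝓛' F ≤ Tnorm pN 𝓛 F := by
  refine Tnorm_le fun g hg => ?_
  exact abs_pairing_le_Tnorm hC F (h hg)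

end Tphi

namespace RGNorm

open Finset Tphi Literature.Probability.LatticeModels

variable {Λ ι S : Type*} [AddCommGroup Λ] [Fintype Λ] [Fintype ι] (step : S → Λ)

/-- **The unit balls of the lattice norms are nested**: for `0 < 𝔥' ≤ 𝔥` and `0 < R ≤ R'`,
`B(Φ(𝔥', R')) ⊆ B(Φ(𝔥, R))` — i.e. `‖g‖_{Φ(𝔥,R)} ≤ ‖g‖_{Φ(𝔥',R')}` ("`‖g‖_{Φ_{j-1}(𝔥_{j-1})} ≤ ‖g‖_{Φ_j(𝔥_j')} ≤ ‖g‖_{Φ_j(𝔥_j'')}`",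
the weights being `𝔥^{-|z|} R^{|α|}` with `R = L^j` increasing in `j`). [cite: BrydgesSlade2015, §3.1.2 (display (e:g-norms))] -/
theorem ball_latticeFamily_subset {𝔥 𝔥' R R' : ℝ} (h𝔥' : 0 < 𝔥') (h𝔥𝔥' : 𝔥' ≤ 𝔥) (hR : 0 < R) (hRR' : R ≤ R')
    (pΦ pN : ℕ) :
    ball pN (latticeFamily step 𝔥' R' pΦ (ι := ι)) ⊆ ball pN (latticeFamily step 𝔥 R pΦ) := by
  intro g hg
  refine ⟨hg.1, ?_⟩
  rintro ℓ ⟨α, z, hα, rfl⟩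
  have hR' : 0 < R' := hR.trans_le hRR'
  have h := abs_napply_le_of_mem_ball step h𝔥' hR' hg hα
  rw [latticeFun_apply, abs_mul, abs_mul, abs_inv, abs_of_pos (pow_pos (h𝔥'.trans_le h𝔥𝔥') _),
    abs_of_pos (pow_pos hR _)]
  have h1 : 0 < 𝔥 ^ z.length := pow_pos (h𝔥'.trans_le h𝔥𝔥') _
  have h2 : 0 < R ^ α.length := pow_pos hR _
  rw [mul_assoc, inv_mul_le_iff₀ h1, mul_one]
  calc R ^ α.length * |napply step α g z| ≤ R ^ α.length * (𝔥' ^ z.length * (R' ^ α.length)⁻¹) :=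
        mul_le_mul_of_nonneg_left h h2.le
    _ ≤ R' ^ α.length * (𝔥 ^ z.length * (R' ^ α.length)⁻¹) := by
        gcongr
    _ = 𝔥 ^ z.length := by
        field_simp

/-- **[BS-rg-IE] Lemma 3.1.2 (scale monotonicity of the `T_φ` seminorm), bulk case**:
`‖F‖_{T_φ(Φ(𝔥',R'))} ≤ ‖F‖_{T_φ(Φ(𝔥,R))}` whenever `0 < 𝔥' ≤ 𝔥` and `0 < R ≤ R'` — in particular
`‖F‖_{T_{φ,j}(𝔥_j'')} ≤ ‖F‖_{T_{φ,j}(𝔥_j')} ≤ ‖F‖_{T_{φ,j-1}(𝔥_{j-1})}` for `𝔥'' ≤ 𝔥' ≤ 𝔥_{j-1}`,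
`R = L^{j-1} ≤ L^j = R'` ("we obtain the stronger inequality with `≺` replaced by `≤`").
[cite: BrydgesSlade2015, Lemma 3.1.2 (case α = ∅ of the proof)] -/
theorem TphiNorm_mono {E : Type*} [NormedAddCommGroup E] [NormedSpace ℝ E] {𝔥 𝔥' R R' : ℝ} (h𝔥' : 0 < 𝔥')
    (h𝔥𝔥' : 𝔥' ≤ 𝔥) (hR : 0 < R) (hRR' : R ≤ R') (pΦ pN : ℕ) (e : Λ × ι → E) (F : E → ℝ) (φ : E) :
    TphiNorm pN (latticeFamily step 𝔥' R' pΦ) e F φ ≤ TphiNorm pN (latticeFamily step 𝔥 R pΦ) e F φ := by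
  unfold TphiNorm
  exact Tnorm_mono_of_ball_subset (latticeFamily_evalBound step (h𝔥'.trans_le h𝔥𝔥') hR pΦ pN (ι := ι))
    (ball_latticeFamily_subset step h𝔥' h𝔥𝔥' hR hRR' pΦ pN) _

end RGNorm

end LongRangePhi4

end Literature.Barriers.CriticalPhenomena
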